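import Summits.CriticalPhenomena.Ising3DConformalLimit.Theses.SubPtolemyInterlacing
import Summits.CriticalPhenomena.Ising3DConformalLimit.Theorems.SubPtolemyInterlacingSubPtolemyFloorConditionalClosings
import Literature.Probability.LatticeModels.CriticalTwoPointDCPLowerHolds
import Summits.CriticalPhenomena.Ising3DConformalLimit.Theorems.SubPtolemyInterlacingSubPtolemyFloorScreenedGradient
import Summits.CriticalPhenomena.Ising3DConformalLimit.Theorems.SubPtolemyInterlacingSubPtolemyFloorScreenedAxisLower
import Summits.CriticalPhenomena.Ising3DConformalLimit.Theorems.SubPtolemyInterlacingSubPtolemyFloorScreenedEtaBound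
import HarnessLib

/-!
# Line `source-cluster-screening` — crux stmt-CriticalPhenomena-15703 `SubPtolemyFloor`
# (route SubPtolemyInterlacing, r3): the reflected-gradient inequality WITH THE SCREENING KEPT

Crux (verbatim): `∃ a c : ℝ, a < Real.logb 2 (1 + √2) ∧ 0 < c ∧ ∀ n ≥ 1, c·n^{-a} ≤ ⟨σ₀σ_{ne₁}⟩_{β_c(3)}`
(one-sided `η(3) < L⋆ - 1 = 0.27155`, `L⋆ := log₂(1+√2)`).

## Idea (strategist, 2026-08-17; NOT one of the dead transfer currencies)

Duminil-Copin–Panis 2025 (arXiv:2404.05700, tree `dcp_reflectedGradient_lower_holds`) prove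
`β Σ_{x,y∈Λ_n, y∼x} (G(x) - G(𝓡_n x)) G(y, 𝓡_n y) ≥ c₀` (Thm 1.2) and deduce `η ≤ 1/2` if `η` exists
(Thm 1.5). Under a pure power law `G ~ r^{-(1+η)}` the left side of Thm 1.2 is `~ n^{1-2η}`: the deduction
1.2 → 1.3 → 1.5 is exponent-LOSSLESS, so the whole `d = 3` deficit of the method (0.93 in the exponent at the
bootstrap value `η = 0.036`) sits INSIDE the proof of Thm 1.2, namely in the two Griffiths-monotonicity
steps of Lemma 2.5 (tree `IsFoldable.lemma25`, steps 1 and 4 of its docstring): the reflected connection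
`y ↔ ℍ_n` of the neighbour `y` of `x` has to be realised in the complement `Λ ∖ 𝒞_n(0)` of the (deleted)
source cluster of `{0,x}`, and `⟨σ_yσ_{θy}⟩_{Λ∖𝒞} ≤ ⟨σ_yσ_{θy}⟩_Λ` throws this SCREENING away. Screening of
a critical connection by an adjacent, independent critical cluster of dimension `≈ 2` is a non-intersection
event of two dimension-2 fractals in `ℝ³`: its Brownian calibration is Lawler's exponent
`ξ₃(1,1) ∈ [1/2, 1)` (rigorous for Brownian paths; numerically ≈ 0.57), positive exactly for `d < 4`
— which is also exactly where DCP stops being sharp (`d ≥ 5` sharp, `d = 4` log). Keeping a polynomial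
screening gain `n^{-s}` in Lemma 2.5 (summed over the box; stub E below) turns Thm 1.3 into
`G(ne₁)(χ_{4n} + nΣ_{k≤2n} kG(ke₁)) ≥ c₁ n^{s}` (stubs S1–S2), hence `η exists ⇒ 1 + η ≤ (3-s)/2` (S3), and
`(3-s)/2 < L⋆ ⇔ s > 3 - 2L⋆ = 0.4569` — BELOW the rigorous Brownian value `1/2`. With `η`-existence
(stub S4 = the birth skeleton's `stub_etaExists`, free inside the route from r4 `MoebiusLimit`) the landed
bridge `SubPtolemyFloorPlusWall.subPtolemyFloor_of_hasIsingExponentEta` (p131889) concludes the crux BY NAME.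

Load-bearing stub: `stub_screenedLemma25` (E). It is NOT crux-equivalent under scaling (its content is a
boundary/screening exponent, not `Δ_σ`), it is an UPPER bound on correlations (the direction with tools),
it is finite-range specific (a long bond jumps the deleted cluster: honours `LongRangeTrivialityOnZ3`) and
`d = 3` specific (`s = 0` for `d ≥ 4`: honours `IsingTrivialityFromDimensionFour`); any partial `s > 0`
already improves the printed frontier to `η ≤ (1-s)/2` through S1–S3, which are stated for every `s ≥ 0`.

Stubs S1–S3 are genuine M-sized adaptations of tree theorems (`DCPNearCritical.torusIneq_of_lemma25_weight` /
`infiniteVolume_ineq_of_lemma25` / `reflectedGradient_nearCritical_of_lemma25`;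
`dcp_criticalTwoPoint_axis_lower_of_reflectedGradient_nearCritical`; `dcp_isingEta_le_half_of_axis_lower`)
with the gain `n^{s}` carried through; nothing in them is open.

## STATUS (lead c3 `prover-line-stmt-CriticalPhenomena-15703-c3-0`, 2026-08-17, cycle 1)

* S1 `stub_screenedGradient` — LANDED p142397 (`SubPtolemyFloorScreening.screenedGradient_of_screenedLemma25`,
  `Theorems/SubPtolemyInterlacingSubPtolemyFloorScreenedGradient.lean`; Literature helper
  `SharpLengthDCPTorusScreened.lean` p141464: `DCPNearCritical.torusIneq_of_lemma25_sum`,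
  `infiniteVolume_ineq_of_lemma25_sum` — Lemma 2.5 SUMMED with a gain `κ`, general `d`, weight `w`).
* S2 `stub_screenedAxisLower` — LANDED p141419 (`SubPtolemyFloorScreening.screenedAxisLower_of_screenedGradient`).
* S3 `stub_etaBound` — LANDED p141599 (`SubPtolemyFloorScreening.etaBound_of_screenedAxisLower`; helper
  `screenedDenominator_le` for every decay exponent `b < 1`).
* Engine reduction S0 (lead) — `SubPtolemyFloorScreening.screenedLemma25_of_screenedSourcedEvent` (p142963,
  `Theorems/…ScreenedSourcedEvent.lean`): `ScreenedTorusLemma25 s C` ⇐ the SCREENED SOURCED-EVENT bound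
  `Σ_{x∼y} Z^{0̄x̄}[0̄,x̄ ↮ ℍ, ȳ ↔ ℍ] ≤ C n^{-s} Σ_{x∼y} (Z^{0̄x̄} - Z^{0̄,θx̄})⟨σ_ȳσ_{θȳ}⟩` (steps 1–2 of Lemma 2.5
  isolated; by step 3 + exact outer switching its left side is `Σ Z^{0x}[𝒞(0)=S]·⟨σ_yσ_{θy}⟩_{Λ∖S}`: the mean
  screening ratio of the reflected connection of `y` by the adjacent source cluster) — the recommended shape of
  the engine if it is promoted to an item; calibration `screenedSourcedEvent_zero_one` (`s = 0`, `C = 1` is a theorem).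
* Certificates (lead, `Theorems/…ScreeningCertificate.lean`, p144220): `one_add_eta_le_of_screenedLemma25` (ANY gain `s ≥ 0`
  ⇒ `η ≤ (1-s)/2` conditionally — frontier dividend), `conditionalEta_of_screeningGain` (engine ALONE ⇒ Option B's
  hypothesis `∀ η, HasIsingExponentEta 3 η → η < L⋆ - 1`), `subPtolemyFloor_of_screeningGain` (engine ∧ η-existence ⇒
  crux by name = this skeleton's composition), `screening_closes` (`Interlacing → engine → MoebiusLimit → summit`:
  inside the ROUTE the η-existence stub is supplied by r4), `screenedLemma25_zero_one` (`STL25(0,1)` is a theorem),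
  `screenedLemma25_false_of_one_lt` (the engine is FALSE for `s > 1`: infrared bound) — window `0.4569 < s ≤ 1`.
* Screening identity (lead, `Theorems/…ScreeningIdentity.lean`, p143769): `sourcedEvent_eq_screening`
  `Z^{ox}[o,x ↮ ℍ, y ↔ ℍ] = Σ_S ⟨σ_yσ_{θy}⟩_{Λ∖S}·Z^{ox}[𝒞(o) = S]` (exact versions `outer_connFix_eq`, `cset_connFix_eq` of
  the tree's steps 3–4) and `screening_dropped_le`: the engine = decay `n^{-s}` of the `B(n)`-weighted mean screening ratio
  `⟨σ_yσ_{θy}⟩_{Λ∖𝒞(o)}/⟨σ_yσ_{θy}⟩_Λ`, kernel-precisely.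
* OPEN: E `stub_screenedLemma25` (new screening exponent; no print result gives any `s > 0`; a rigorous `s > 0`
  needs a per-scale lower bound on the intersection of two adjacent-rooted critical current clusters in `ℤ³`,
  i.e. a 3D quasi-multiplicativity / annulus regularity of current connections — open) and S4 `stub_etaExists`
  (existence of `η(3)`, open stand-alone, Duminil-Copin ICM 2022 §8.4; free inside the route from r4).

## STATUS (lead c6 `prover-line-stmt-CriticalPhenomena-15703-c6-0`, 2026-08-17T19:05Z — skeleton RE-ADOPTED unchanged)

All four payload lines of leads c4–c6 (Sketch, Sketch-plus-wall-quotient-ladder, RouteNoteSketch-k1, HybridCloses) are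
dead with evidence (`Lines/*_dead.md`); this is the one line of the crux directory that is not, so lead c6 re-registers
it (the item's registered stub list had been left on the dead `stub_steinWitness` of `Lines/Sketch.lean`).
Open stubs, unchanged: E `stub_screenedLemma25` (= child `ScreeningGain` of the prepared decomposition SPLIT-D2,
glue `SubPtolemyFloorScreening.subPtolemyFloor_of_screeningGain` landed p144220) and S4 `stub_etaExists`
(= child `EtaExists`, free in-route from r4, p135087). c6 holds E: first action = the worm-free falsifier of
STRATEGY-CENSUS gen 1 §N6 (growth exponents a′ of the screened left side A(n) and b′ of the reflected-gradient
sum B(n) on tori L = 4n+2 ≤ 66 at β_c(3); E physically true iff s = b′ − a′ > 3 − 2·log₂(1+√2) = 0.457) as one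
kit job attached to the item. Also landed this seat: `Theorems/SubPtolemyFloor/Negative/CollinearCeiling.lean`
(p173023, rung-harvest ceiling lemma: the route threshold is sharp for the whole collinear Gaussian family).
-/

noncomputable section

namespace Summit.CriticalPhenomena.Ising3DConformalLimit.Cruxes.SubPtolemyFloor.SourceClusterScreening

open Finset Literature.Probability.LatticeModels
open Literature.Probability.LatticeModels.DCPLower
open Summit.CriticalPhenomena.Ising3DConformalLimit.Theses.SubPtolemyInterlacing
open scoped ENNReal symmDiff Classical

/-! ## The three currencies of the line, as named propositions (bodies, no axioms) -/

/-- **Screened torus Lemma 2.5, summed over the box, with polynomial gain `C·n^{-s}`** (the ENGINE's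
currency). For every `n ≥ 1`, every even torus `(ℤ/Lℤ)³` with `L ≥ 4n+2` and every direction `δ`, the
SUM over neighbour pairs `x ∼ y` of `Λ_n` of the left side of Duminil-Copin–Panis' Lemma 2.5 at `β_c(3)`
(verbatim the tree's per-pair torus term of `DCPNearCritical.lemma25_torus`: the sourceless-current
expectation of `𝟙[0̄,x̄ ∈ 𝒮¹_n, ȳ ↔ ℍ_δ]·⟨σ_0̄σ_x̄⟩_{𝒮¹_n}`) is at most `C n^{-s}` times the SUM of its printed
right sides `(Z^{0̄x̄} - Z^{0̄,θx̄})·⟨σ_ȳσ_{θȳ}⟩_{𝕋_L}`. For `s = 0`, `C = 1` this IS Lemma 2.5 summed (a theorem);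
`s > 0` is the screening of the reflected connection `y ↔ ℍ` by the deleted source cluster `𝒞_n(0) ∋ x ∼ y`
that step 4 of the printed proof discards. [cite: DuminilCopinPanis2025LowerBounds, Lemma 2.5 and its proof, steps (2.21)–(2.23)] -/
def ScreenedTorusLemma25 (s C : ℝ) : Prop :=
  ∀ (n : ℕ) (_hn : 1 ≤ n) (L : ℕ) [NeZero L] (hL : Even L) (hnL : 4 * n + 2 ≤ L) (δ : Fin 3 × Bool),
    (∑ x ∈ box 3 n, ∑ y ∈ box 3 n,
      if (zdGraph 3).Adj x y then
        ∑' nc : edgesIn (torusGraph 3 L) univ → ℕ,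
          ind (csources (torusGraph 3 L) univ nc = ∅ ∧
              CSupp (torusGraph 3 L) univ (edgesIn (torusGraph 3 L) univ) nc) *
            cweight (torusGraph 3 L) univ (criticalBeta 3) nc *
            (ind (¬ (isFoldable_dir hL (by omega) n δ).ConnFix ((isFoldable_dir hL (by omega) n δ).fold nc)
                    (Torus.proj L (0 : Site 3)) ∧
                  ¬ (isFoldable_dir hL (by omega) n δ).ConnFix ((isFoldable_dir hL (by omega) n δ).fold nc)
                    (Torus.proj L x) ∧
                  (isFoldable_dir hL (by omega) n δ).ConnFix ((isFoldable_dir hL (by omega) n δ).fold nc)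
                    (Torus.proj L y)) *
              ENNReal.ofReal (isingTwoPoint (torusGraph 3 L)
                (((box 3 n).filter fun z => ¬ (isFoldable_dir hL (by omega) n δ).ConnFix
                    ((isFoldable_dir hL (by omega) n δ).fold nc) (Torus.proj L z)).image (Torus.proj L))
                (criticalBeta 3) 0 .free (Torus.proj L (0 : Site 3)) (Torus.proj L x)))
      else 0) ≤
    ENNReal.ofReal (C * (n : ℝ) ^ (-s)) *
      ∑ x ∈ box 3 n, ∑ y ∈ box 3 n,
        if (zdGraph 3).Adj x y then
          (currentZ (torusGraph 3 L) univ (criticalBeta 3) (edgesIn (torusGraph 3 L) univ)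
                ({Torus.proj L (0 : Site 3)} ∆ {Torus.proj L x}) -
              currentZ (torusGraph 3 L) univ (criticalBeta 3) (edgesIn (torusGraph 3 L) univ)
                ({Torus.proj L (0 : Site 3)} ∆ {dirTheta L n δ (Torus.proj L x)})) *
            ENNReal.ofReal (isingTwoPoint (torusGraph 3 L) univ (criticalBeta 3) 0 .free (Torus.proj L y)
              (dirTheta L n δ (Torus.proj L y)))
        else 0

/-- **Screened reflected-gradient inequality** (Thm 1.2 at `β_c(3)` with gain `n^{s}`): in the rendering
of the tree's named fact `dcp_reflectedGradient_lower` (first axis, free state at `β_c`),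
`c₀ n^{s} ≤ Σ_{x,y∈Λ_n, y∼x} (⟨σ₀σ_x⟩ - ⟨σ₀σ_{𝓡_n x}⟩) ⟨σ_yσ_{𝓡_n y}⟩` for `n ≥ N₀`. For `s = 0` it is
the tree theorem `dcp_reflectedGradient_lower_holds`. [cite: DuminilCopinPanis2025LowerBounds, Theorem 1.2] -/
def ScreenedReflectedGradient (s : ℝ) : Prop :=
  ∃ c₀ : ℝ, 0 < c₀ ∧ ∃ N₀ : ℕ, 0 < N₀ ∧ ∀ n : ℕ, N₀ ≤ n →
    c₀ * (n : ℝ) ^ s ≤ ∑ x ∈ box 3 n, ∑ y ∈ box 3 n,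
      if (zdGraph 3).Adj x y then
        (twoPointFree 3 (criticalBeta 3) x -
            twoPointFree 3 (criticalBeta 3) (dcpReflect (⟨0, by omega⟩ : Fin 3) (n : ℤ) x)) *
          freeExpect 3 (criticalBeta 3) 0
            (spinPair y (dcpReflect (⟨0, by omega⟩ : Fin 3) (n : ℤ) y))
      else 0

/-- **Screened axial lower bound** (Thm 1.3 at `β_c(3)` with gain `n^{s}`): in the rendering of the
tree's named fact `dcp_criticalTwoPoint_axis_lower`,
`c₁ n^{s} / (χ_{4n} + n Σ_{1≤k≤2n} k ⟨σ₀σ_{ke₁}⟩) ≤ ⟨σ₀σ_{ne₁}⟩` for `n ≥ N₁`. For `s = 0` it is the tree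
theorem `dcp_criticalTwoPoint_axis_lower_holds`. [cite: DuminilCopinPanis2025LowerBounds, Theorem 1.3] -/
def ScreenedAxisLower (s : ℝ) : Prop :=
  ∃ c₁ : ℝ, 0 < c₁ ∧ ∃ N₁ : ℕ, 0 < N₁ ∧ ∀ n : ℕ, N₁ ≤ n →
    c₁ * (n : ℝ) ^ s / ((∑ x ∈ box 3 (4 * n), twoPointFree 3 (criticalBeta 3) x) +
          (n : ℝ) ^ (3 - 2) *
            ∑ k ∈ Finset.Icc 1 (2 * n),
              (k : ℝ) * twoPointFree 3 (criticalBeta 3) (Pi.single (⟨0, by omega⟩ : Fin 3) (k : ℤ)))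
      ≤ twoPointFree 3 (criticalBeta 3) (Pi.single (⟨0, by omega⟩ : Fin 3) (n : ℤ))

/-! ## The stubs -/

/-- **Stub E — the ENGINE (screening of the reflected connection by the source cluster; open).**
There are `s > 3 - 2·log₂(1+√2) = 0.45689…` and `C > 0` with `ScreenedTorusLemma25 s C`: summed over the
neighbour pairs of `Λ_n`, the random-current left side of Lemma 2.5 is smaller than DCP's bound by `n^{-s}`.
Why plausibly true: the slack of Lemma 2.5 is the probability that the sourceless cluster of `y` reaches the
mirror hyperplane (distance `≍ n` for the dominant pairs) while AVOIDING the adjacent source cluster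
`𝒞_n(0) ∋ x` of extent `≥ ‖x‖` — a non-intersection event for two independent critical clusters of
dimension `2 - η ≈ 1.96` in `ℝ³`; Brownian calibration `ξ₃(1,1) ∈ [1/2,1)` (Lawler, *Intersections of
random walks*, §5.1–5.2; numerics 0.57), and `1/2 > 0.457`; consistency: the same exponent is `0` in
`d ≥ 4` (two dimension-2 sets miss each other), exactly where DCP's inequality is sharp / log-sharp.
Why it might fail: (i) physically, if critical current clusters screen markedly LESS than Brownian paths
(`s_true < 0.457`; no numerics exist — cheapest falsifier: a worm-algorithm measurement of the growth
exponent `a'` of the A-side `E^∅[𝟙_{0∈𝒮}φ_{β_c}(𝒮_n)]`, the engine holds iff `a' < 0.47`); (ii) provably,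
a per-scale lower bound on the intersection probability of two adjacent-rooted critical clusters in `ℤ³`
is an open piece of the 3D non-triviality circle (barrier `TransverseCrossingsNeedNotMeet`: no topological
forcing in `d = 3`; the bet is entropic forcing, dimension `1.96 + 1.96 > 3`). Size: XL / open.
Leans on: `IsFoldable.lemma25` steps 1–3, 5 (exact), `IsFoldable.tsum_outer_connFix_le` (the step to beat).
[cite: DuminilCopinPanis2025LowerBounds, Lemma 2.5, proof, eqs. (2.21)–(2.23) (the two Griffiths steps)] -/
theorem stub_screenedLemma25 :
    ∃ s C : ℝ, 3 - 2 * Real.logb 2 (1 + Real.sqrt 2) < s ∧ 0 < C ∧ ScreenedTorusLemma25 s C := by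
  sorry

/-- **Stub S1 — integration, torus limit, symmetry, Lemma 2.4 with the gain carried (provable; size M–L).**
For every `s ≥ 0`, `C > 0`: `ScreenedTorusLemma25 s C → ScreenedReflectedGradient s`. Proof = the tree's
`DCPNearCritical.torusIneq_of_lemma25_weight` (which consumes Lemma 2.5 only through the SUM over pairs),
`infiniteVolume_ineq_of_lemma25` (even tori `L → ∞` at `m*(β_c) = 0`), the hyperoctahedral symmetry over
the `2d` directions and Lemma 2.4 (`2d⟨σ₀σ_{2ne₁}⟩ ≤ 1/2` for `n ≥ N₀`, infrared bound), giving
`n^{s}/(16·3·β_c·C) ≤ Σ_{x,y}(…)`. [cite: DuminilCopinPanis2025LowerBounds, §2.2, eqs. (2.5)–(2.8) with Lemma 2.4] -/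
theorem stub_screenedGradient :
    ∀ s C : ℝ, 0 ≤ s → 0 < C → ScreenedTorusLemma25 s C → ScreenedReflectedGradient s :=
  -- LANDED (wave 1, p142397; Literature helper `SharpLengthDCPTorusScreened.lean` p141464)
  fun s C hs hC hE => SubPtolemyFloorScreening.screenedGradient_of_screenedLemma25 s C hs hC hE

/-- **Stub S2 — "Theorem 1.2 at scale `4n` ⟹ Theorem 1.3 at scale `n`" with the gain carried (provable;
size M).** For every `s ≥ 0`: `ScreenedReflectedGradient s → ScreenedAxisLower s`. Proof = the tree's
`dcp_criticalTwoPoint_axis_lower_of_reflectedGradient_nearCritical` at `β_c` (split `x₁ ≤ n/2` bounded by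
`χ_n⟨σ₀σ_{(n/4)e₁}⟩` via MMS; `x₁ > n/2` via the spectral gradient estimate
`twoPointFree_criticalBeta_gradient_estimate`), with `c₀` replaced by `c₀(4n)^{s} ≥ c₀ n^{s}`.
[cite: DuminilCopinPanis2025LowerBounds, Theorem 1.3, proof (end of §1.1)] -/
theorem stub_screenedAxisLower : ∀ s : ℝ, 0 ≤ s → ScreenedReflectedGradient s → ScreenedAxisLower s :=
  -- LANDED (wave 1, p141419)
  fun s hs h => SubPtolemyFloorScreening.screenedAxisLower_of_screenedGradient s hs h

/-- **Stub S3 — power counting under `η`-existence (provable; size M).** For every `s ≥ 0`,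
`ScreenedAxisLower s` implies: if `η(3)` exists (log sense) then `1 + η ≤ (3 - s)/2`. Proof = the tree's
`dcp_isingEta_le_half_of_axis_lower` with the gain: were `2(1+η) > 3 - s`, pick `ε > 0` with
`2(1+η) > 3 - s + 4ε`; the ansatz gives `k‖x‖^{-(1+η+ε)} ≤ ⟨σ₀σ_x⟩ ≤ K‖x‖^{-(1+η-ε)}` for large `x`, so the
denominator is `≤ C n^{2-η+ε}` and the left side of `ScreenedAxisLower` is `≥ c n^{s-2+η-ε}`, against the
upper ansatz `K n^{-(1+η-ε)}`: `s - 2 + η - ε ≤ -1 - η + ε` eventually, i.e. `2(1+η) ≤ 3 - s + 2ε`, absurd.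
(`η ≤ 1` from Simon's bound keeps the sums in the polynomial regime, as in the tree proof.)
[cite: DuminilCopinPanis2025LowerBounds, Theorem 1.5 and its proof (arXiv p. 6)] -/
theorem stub_etaBound :
    ∀ s : ℝ, 0 ≤ s → ScreenedAxisLower s →
      ∀ η : ℝ, HasIsingExponentEta 3 η → 1 + η ≤ (3 - s) / 2 :=
  -- LANDED (wave 1, p141599)
  fun s hs h η hη => SubPtolemyFloorScreening.etaBound_of_screenedAxisLower s hs h η hη

/-- **Stub S4 — existence of `η(3)` (= the birth skeleton's `stub_etaExists`; open stand-alone, FREE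
inside the route: r4 `MoebiusLimit` gives it, `Birth.etaExists_of_moebiusLimit`, landed
`SubPtolemyFloorHybrid.hasIsingExponentEta_of_scaleCovariant_limit` p135087).** Structurally necessary for
an ALL-`n` floor from any self-improving inequality: with only the infrared bound for the denominator,
`ScreenedAxisLower s` gives the all-`n` exponent `2 - s`, and `2 - s < L⋆` would need `s > 0.73`, more than
the total slack of Lemma 2.5. [cite: DuminilCopinICM2022, §4.2.1 and §8.4 (existence of η(3) open)] -/
theorem stub_etaExists : ∃ η : ℝ, HasIsingExponentEta 3 η := by
  sorry

/-! ## Composition: the stubs conclude the crux BY NAME (real proof; every `sorry` is inside a stub) -/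

/-- `log₂(1+√2) < 3/2` (`1 + √2 < 2√2`), so the engine's window `s > 3 - 2·log₂(1+√2)` lies in `s > 0`.
[folklore] -/
theorem threshold_lt_three_halves : Real.logb 2 (1 + Real.sqrt 2) < 3 / 2 :=
  SubPtolemyFloorNegative.threshold_lt_three_halves

/-- **The skeleton theorem**: E, S1, S2, S3, S4 ⟹ `SubPtolemyFloor` (the route decl, by name). Take the
engine's `s > 3 - 2L⋆` (so `s > 0`) and `C`; S1–S3 give `1 + η ≤ (3-s)/2 < L⋆` for the `η` of S4, i.e.
`η < L⋆ - 1`; the landed bridge `SubPtolemyFloorPlusWall.subPtolemyFloor_of_hasIsingExponentEta` (p131889)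
turns this into the all-`n` axial floor. [cite: DuminilCopinPanis2025LowerBounds, Theorem 1.5 (shape of the deduction)] -/
theorem SubPtolemyFloor_of :
    Summit.CriticalPhenomena.Ising3DConformalLimit.Theses.SubPtolemyInterlacing.SubPtolemyFloor := by
  obtain ⟨s, C, hs, hC, hE⟩ := stub_screenedLemma25
  have hs0 : 0 ≤ s := by linarith [threshold_lt_three_halves]
  have h12 : ScreenedReflectedGradient s := stub_screenedGradient s C hs0 hC hE
  have h13 : ScreenedAxisLower s := stub_screenedAxisLower s hs0 h12
  obtain ⟨η, hη⟩ := stub_etaExists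
  have hb : 1 + η ≤ (3 - s) / 2 := stub_etaBound s hs0 h13 η hη
  exact SubPtolemyFloorPlusWall.subPtolemyFloor_of_hasIsingExponentEta η hη (by linarith)

-- Hypothesis form of the composition, SORRY-FREE and independent of the stubs.
example :
    (∃ s C : ℝ, 3 - 2 * Real.logb 2 (1 + Real.sqrt 2) < s ∧ 0 < C ∧ ScreenedTorusLemma25 s C) →
    (∀ s C : ℝ, 0 ≤ s → 0 < C → ScreenedTorusLemma25 s C → ScreenedReflectedGradient s) →
    (∀ s : ℝ, 0 ≤ s → ScreenedReflectedGradient s → ScreenedAxisLower s) →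
    (∀ s : ℝ, 0 ≤ s → ScreenedAxisLower s → ∀ η : ℝ, HasIsingExponentEta 3 η → 1 + η ≤ (3 - s) / 2) →
    (∃ η : ℝ, HasIsingExponentEta 3 η) →
      Summit.CriticalPhenomena.Ising3DConformalLimit.Theses.SubPtolemyInterlacing.SubPtolemyFloor := by
  rintro ⟨s, C, hs, hC, hE⟩ h1 h2 h3 ⟨η, hη⟩
  have hs0 : 0 ≤ s := by linarith [threshold_lt_three_halves]
  exact SubPtolemyFloorPlusWall.subPtolemyFloor_of_hasIsingExponentEta η hη
    (by linarith [h3 s hs0 (h2 s hs0 (h1 s C hs0 hC hE)) η hη])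

/-! ## Sorry-free dividends: the `s = 0` instances are tree theorems (calibration of the currencies) -/

/-- `ScreenedReflectedGradient 0` is Duminil-Copin–Panis' Theorem 1.2 at `β_c(3)` (tree theorem).
[cite: DuminilCopinPanis2025LowerBounds, Theorem 1.2] -/
theorem screenedReflectedGradient_zero : ScreenedReflectedGradient 0 := by
  obtain ⟨c₀, hc₀, N₀, hN₀, h⟩ := dcp_reflectedGradient_lower_holds (d := 3) (by norm_num)
  refine ⟨c₀, hc₀, N₀, hN₀, fun n hn => ?_⟩
  simpa using h n hn

/-- `ScreenedAxisLower 0` is Duminil-Copin–Panis' Theorem 1.3 at `β_c(3)` (tree theorem).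
[cite: DuminilCopinPanis2025LowerBounds, Theorem 1.3] -/
theorem screenedAxisLower_zero : ScreenedAxisLower 0 := by
  obtain ⟨c₁, hc₁, N₁, hN₁, h⟩ := dcp_criticalTwoPoint_axis_lower_holds (d := 3) (by norm_num)
  refine ⟨c₁, hc₁, N₁, hN₁, fun n hn => ?_⟩
  simpa using h n hn

/-- The printed frontier in the line's last currency: `η ≤ 1/2 = (3 - 0)/2 - 1` (tree theorem, DCP Thm 1.5);
the engine asks for the gain `s > 0.4569`. [cite: DuminilCopinPanis2025LowerBounds, Theorem 1.5] -/
theorem etaBound_zero : ∀ η : ℝ, HasIsingExponentEta 3 η → 1 + η ≤ (3 - 0) / 2 := by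
  intro η hη
  have := dcp_isingEta_le_half_holds η hη
  linarith

end Summit.CriticalPhenomena.Ising3DConformalLimit.Cruxes.SubPtolemyFloor.SourceClusterScreening

end
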